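import Summits.CriticalPhenomena.SAWScalingLimit.Theorems.BoundaryTP2Negative_Enumeration
import Summits.CriticalPhenomena.SAWScalingLimit.Theorems.BoundaryTP2Negative_BoxDomain
import Literature.Probability.RandomPlanarGeometry.SelfAvoidingWalkProofs
import HarnessLib

/-!
# Negative knowledge on crux `BoundaryTP2`, part 3: the 3 × 3 box, exact two-point sums

The box `{0,1,2}²` as `Ω₃ = siteDomain (boxSites (0,0) (2,2))`: bounded, simply connected, domain graph =
`ℤ²` induced on the box (`adj₃_iff`); neighbour lists `nb₃` (complete and sound), the length bound
`length_le_eight`, and **exact two-point sums** `Z₃_eq` at every fugacity by certified complete enumeration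
(kernel `decide`), e.g. `Z((0,0),(1,1)) = 2x²+2x⁴+2x⁶+2x⁸`, `Z((0,1),(2,1)) = x²+6x⁴+2x⁶`.  Everything proved;
`xc_nonneg` is the unconditional `x_c > 0` (from `μ ≥ 2`). [folklore]
-/

namespace Summit.CriticalPhenomena.SAWScalingLimit.Theorems.BoundaryTP2.Negative

open Literature.Probability.LatticeModels Literature.Probability.RandomPlanarGeometry
open scoped ENNReal

section Box3


/-- The 3 × 3 box of sites as a lattice Dobrushin datum (nothing wired). [folklore] -/
def L₃ : LatticeDobrushin := LatticeDobrushin.ofBox ![0, 0] ![2, 2] ∅ (Set.empty_subset _)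

/-- The 3 × 3 box domain `(-½, 5/2)²`. [folklore] -/
def Ω₃ : Set ℂ := siteDomain (boxSites ![0, 0] ![2, 2])

/-- `Ω₃` is bounded. [folklore] -/
theorem isBounded_Ω₃ : Bornology.IsBounded Ω₃ := isBounded_siteDomain (boxSites_finite _ _)

/-- `Ω₃` is simply connected (an open square). [folklore] -/
theorem simplyConnectedSpace_Ω₃ : SimplyConnectedSpace Ω₃ :=
  simplyConnectedSpace_siteDomain_boxSites (Fin.forall_fin_two.2 ⟨by decide, by decide⟩)

/-- The domain graph of `Ω₃` is `ℤ²` induced on the box. [folklore] -/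
theorem adj₃_iff {x y : Site 2} : (discreteDomainGraph Ω₃ 1).Adj x y ↔
    (zdGraph 2).Adj x y ∧ x ∈ boxSites ![0, 0] ![2, 2] ∧ y ∈ boxSites ![0, 0] ![2, 2] :=
  L₃.adj_iff

/-- Membership in a box of sites is decidable. [folklore] -/
instance decMemBoxSites (x a b : Site 2) : Decidable (x ∈ boxSites a b) :=
  decidable_of_iff _ (mem_boxSites_iff (a := a) (b := b) (x := x)).symm

/-- Boolean membership in the box. [folklore] -/
def inBox₃ (x : Site 2) : Bool := decide (0 ≤ x 0) && decide (x 0 ≤ 2) && decide (0 ≤ x 1) && decide (x 1 ≤ 2)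

/-- `inBox₃` is faithful. [folklore] -/
theorem inBox₃_iff (x : Site 2) : inBox₃ x = true ↔ x ∈ boxSites ![0, 0] ![2, 2] := by
  simp only [inBox₃, Bool.and_eq_true, decide_eq_true_eq, mem_boxSites_iff, Fin.forall_fin_two,
    Matrix.cons_val_zero, Matrix.cons_val_one]
  tauto

/-- Boolean equality of sites. [folklore] -/
def eqSite (u v : Site 2) : Bool := (u 0 == v 0) && (u 1 == v 1)

/-- `eqSite` is faithful. [folklore] -/
theorem eqSite_iff (u v : Site 2) : eqSite u v = true ↔ u = v := by
  simp only [eqSite, Bool.and_eq_true, beq_iff_eq]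
  constructor
  · rintro ⟨h0, h1⟩
    exact funext (Fin.forall_fin_two.2 ⟨h0, h1⟩)
  · rintro rfl
    exact ⟨rfl, rfl⟩

/-- Candidate neighbours inside the box (for `u` in the box), in the order E, W, N, S. [folklore] -/
def nb₃ (u : Site 2) : List (Site 2) :=
  if inBox₃ u then [![u 0 + 1, u 1], ![u 0 - 1, u 1], ![u 0, u 1 + 1], ![u 0, u 1 - 1]].filter inBox₃ else []

/-- The four lattice neighbours of a site, as explicit vectors. [folklore] -/
theorem zdGraph_adj_cases {u w : Site 2} (h : (zdGraph 2).Adj u w) :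
    w = ![u 0 + 1, u 1] ∨ w = ![u 0 - 1, u 1] ∨ w = ![u 0, u 1 + 1] ∨ w = ![u 0, u 1 - 1] := by
  obtain ⟨i, hi | hi⟩ := (zdGraph_adj_iff u w).1 h
  · fin_cases i
    · left; rw [hi]; funext j; fin_cases j <;> simp
    · right; right; left; rw [hi]; funext j; fin_cases j <;> simp
  · have hw : w = u - Pi.single i 1 := by rw [hi]; simp
    fin_cases i
    · right; left; rw [hw]; funext j; fin_cases j <;> simp
    · right; right; right; rw [hw]; funext j; fin_cases j <;> simp

/-- `nb₃` lists all neighbours in the domain graph. [folklore] -/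
theorem mem_nb₃ (u w : Site 2) (h : (discreteDomainGraph Ω₃ 1).Adj u w) : w ∈ nb₃ u := by
  rw [adj₃_iff] at h
  obtain ⟨hadj, hu, hw⟩ := h
  rw [nb₃, if_pos ((inBox₃_iff u).2 hu), List.mem_filter]
  refine ⟨?_, (inBox₃_iff w).2 hw⟩
  rcases zdGraph_adj_cases hadj with h | h | h | h <;> simp [h]

/-- The four explicit vectors are lattice neighbours. [folklore] -/
theorem zdGraph_adj_of_cases {u w : Site 2}
    (h : w = ![u 0 + 1, u 1] ∨ w = ![u 0 - 1, u 1] ∨ w = ![u 0, u 1 + 1] ∨ w = ![u 0, u 1 - 1]) :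
    (zdGraph 2).Adj u w := by
  rw [zdGraph_adj_iff]
  rcases h with rfl | rfl | rfl | rfl
  · exact ⟨0, Or.inl (funext (Fin.forall_fin_two.2 ⟨by simp, by simp⟩))⟩
  · exact ⟨0, Or.inr (funext (Fin.forall_fin_two.2 ⟨by simp, by simp⟩))⟩
  · exact ⟨1, Or.inl (funext (Fin.forall_fin_two.2 ⟨by simp, by simp⟩))⟩
  · exact ⟨1, Or.inr (funext (Fin.forall_fin_two.2 ⟨by simp, by simp⟩))⟩

/-- `nb₃` lists only neighbours in the domain graph (soundness). [folklore] -/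
theorem nb₃_adj (u w : Site 2) (h : w ∈ nb₃ u) : (discreteDomainGraph Ω₃ 1).Adj u w := by
  unfold nb₃ at h
  split_ifs at h with hu
  · rw [List.mem_filter] at h
    refine adj₃_iff.2 ⟨zdGraph_adj_of_cases ?_, (inBox₃_iff u).1 hu, (inBox₃_iff w).1 h.2⟩
    simpa using h.1
  · simp at h

/-- The nine sites of the box. [folklore] -/
def T₃ : Finset (Site 2) :=
  {![0, 0], ![0, 1], ![0, 2], ![1, 0], ![1, 1], ![1, 2], ![2, 0], ![2, 1], ![2, 2]}

/-- `T₃` is the box. [folklore] -/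
theorem mem_T₃_iff (x : Site 2) : x ∈ T₃ ↔ x ∈ boxSites ![0, 0] ![2, 2] := by
  constructor
  · intro h
    simp only [T₃, Finset.mem_insert, Finset.mem_singleton] at h
    rw [mem_boxSites_iff, Fin.forall_fin_two]
    rcases h with rfl | rfl | rfl | rfl | rfl | rfl | rfl | rfl | rfl <;> simp
  · intro h
    rw [mem_boxSites_iff, Fin.forall_fin_two] at h
    simp only [Matrix.cons_val_zero, Matrix.cons_val_one] at h
    obtain ⟨⟨h0, h0'⟩, h1, h1'⟩ := h
    have hx : x = ![x 0, x 1] := funext (Fin.forall_fin_two.2 ⟨rfl, rfl⟩)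
    rw [hx]
    simp only [T₃, Finset.mem_insert, Finset.mem_singleton]
    interval_cases (x 0) <;> interval_cases (x 1) <;> simp

/-- The box has nine sites. [folklore] -/
theorem card_T₃ : T₃.card ≤ 9 := by
  unfold T₃
  repeat (refine (Finset.card_insert_le _ _).trans (Nat.succ_le_succ ?_))
  simp

/-- Every SAW of `Ω₃` has at most `8` steps. [folklore] -/
theorem length_le_eight {a b : Site 2} (ha : a ∈ boxSites ![0, 0] ![2, 2]) (γ : SAW.DomainSAW Ω₃ 1 a b) :
    γ.length ≤ 8 := by
  have h := length_lt_card_of_adj_mem T₃ (fun x y hxy => ?_) ((mem_T₃_iff a).2 ha) γ.walk γ.isPath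
  · have := card_T₃
    change γ.walk.length ≤ 8
    omega
  · rw [adj₃_iff] at hxy
    exact ⟨(mem_T₃_iff x).2 hxy.2.1, (mem_T₃_iff y).2 hxy.2.2⟩

/-- Sums of `ofReal (x^k)` over a list. [folklore] -/
theorem sum_map_ofReal_pow {x : ℝ} (hx : 0 ≤ x) (l : List ℕ) :
    (l.map fun k => ENNReal.ofReal (x ^ k)).sum = ENNReal.ofReal (l.map fun k => x ^ k).sum := by
  induction l with
  | nil => simp
  | cons k l ih =>
    simp only [List.map_cons, List.sum_cons]
    rw [ih, ENNReal.ofReal_add (pow_nonneg hx k)]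
    exact List.sum_nonneg (fun t ht => by
      rw [List.mem_map] at ht
      obtain ⟨m, -, rfl⟩ := ht
      exact pow_nonneg hx m)

/-- The fugacity-`x` two-point sum on `Ω₃` (for `x = x_c` this is `SAW.weight Ω₃ 1 a b univ`). [folklore] -/
noncomputable def Z₃ (x : ℝ) (a b : Site 2) : ℝ≥0∞ := ∑' γ : SAW.DomainSAW Ω₃ 1 a b, ENNReal.ofReal (x ^ γ.length)

/-- At the critical fugacity, `Z₃` is the route's weight. [folklore] -/
theorem weight_Ω₃_eq_Z₃ (a b : Site 2) : SAW.weight Ω₃ 1 a b Set.univ = Z₃ SAW.criticalFugacity a b :=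
  weight_univ Ω₃ 1 a b

/-- **Exact two-point sums on the 3 × 3 box by certified complete enumeration**: if the enumerated supports
`a → b` have step counts `lens` (a `decide`-checkable fact), then `Z₃ x a b = Σ_{k ∈ lens} x^k`. [folklore] -/
theorem Z₃_eq {a b : Site 2} (ha : a ∈ boxSites ![0, 0] ![2, 2]) (lens : List ℕ)
    (hnodup : ((pathsFrom eqSite nb₃ 8 a []).filter (endsAt eqSite b)).Nodup)
    (hlens : ((pathsFrom eqSite nb₃ 8 a []).filter (endsAt eqSite b)).map (fun s => s.length - 1) = lens)
    {x : ℝ} (hx : 0 ≤ x) :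
    Z₃ x a b = ENNReal.ofReal (lens.map fun k => x ^ k).sum := by
  have hmap : (((pathsFrom eqSite nb₃ 8 a []).filter (endsAt eqSite b)).map
      fun s => ENNReal.ofReal (x ^ (s.length - 1))).sum = ENNReal.ofReal (lens.map fun k => x ^ k).sum := by
    rw [← sum_map_ofReal_pow hx, ← hlens, List.map_map]
    rfl
  refine le_antisymm ?_ ?_
  · rw [← hmap]
    exact tsum_pow_le_of_enum eqSite eqSite_iff nb₃ mem_nb₃ 8 (length_le_eight ha) hnodup
  · rw [← hmap]
    exact sum_le_tsum_pow_of_enum eqSite eqSite_iff nb₃ nb₃_adj 8 hnodup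

/-- `Z((0,0),(1,1)) = 2x²+2x⁴+2x⁶+2x⁸` (8 SAWs). [folklore] -/
theorem Z₃_00_11 {x : ℝ} (hx : 0 ≤ x) :
    Z₃ x ![0, 0] ![1, 1] = ENNReal.ofReal ([4, 8, 6, 2, 2, 6, 8, 4].map fun k => x ^ k).sum :=
  Z₃_eq (by decide) _ (by decide) (by decide) hx

/-- `Z((0,1),(2,1)) = x²+6x⁴+2x⁶` (9 SAWs). [folklore] -/
theorem Z₃_01_21 {x : ℝ} (hx : 0 ≤ x) :
    Z₃ x ![0, 1] ![2, 1] = ENNReal.ofReal ([2, 4, 4, 4, 4, 6, 4, 4, 6].map fun k => x ^ k).sum :=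
  Z₃_eq (by decide) _ (by decide) (by decide) hx

/-- `x_c ≥ 0` (unconditional: from `μ ≥ 2`). [folklore] -/
theorem xc_nonneg : 0 ≤ SAW.criticalFugacity :=
  SAW.criticalFugacity_pos_lt_one'.1.le

/-- `Z((0,0),(1,1)) ≤ 2x²+2x⁴+2x⁶+2x⁸` at `x_c`. [folklore] -/
theorem weight_00_11_le : SAW.weight Ω₃ 1 ![0, 0] ![1, 1] Set.univ ≤
    ENNReal.ofReal ([4, 8, 6, 2, 2, 6, 8, 4].map fun k => SAW.criticalFugacity ^ k).sum := by
  rw [weight_Ω₃_eq_Z₃, Z₃_00_11 xc_nonneg]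

/-- `Z((0,1),(2,1)) ≤ x²+6x⁴+2x⁶` at `x_c`. [folklore] -/
theorem weight_01_21_le : SAW.weight Ω₃ 1 ![0, 1] ![2, 1] Set.univ ≤
    ENNReal.ofReal ([2, 4, 4, 4, 4, 6, 4, 4, 6].map fun k => SAW.criticalFugacity ^ k).sum := by
  rw [weight_Ω₃_eq_Z₃, Z₃_01_21 xc_nonneg]

/-- An edge of `Ω₃` from decidable data. [folklore] -/
theorem adj₃ {x y : Site 2} (h : (zdGraph 2).Adj x y ∧ x ∈ boxSites ![0, 0] ![2, 2] ∧ y ∈ boxSites ![0, 0] ![2, 2]) :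
    (discreteDomainGraph Ω₃ 1).Adj x y :=
  adj₃_iff.2 h

/-- The one-step SAW `(0,0) → (0,1)`. [folklore] -/
def γ₀₀₀₁ : SAW.DomainSAW Ω₃ 1 ![0, 0] ![0, 1] :=
  ⟨SimpleGraph.Walk.cons (adj₃ (by decide)) SimpleGraph.Walk.nil, by
    simp [SimpleGraph.Walk.isPath_def]⟩

/-- The one-step SAW `(1,1) → (2,1)`. [folklore] -/
def γ₁₁₂₁ : SAW.DomainSAW Ω₃ 1 ![1, 1] ![2, 1] :=
  ⟨SimpleGraph.Walk.cons (adj₃ (by decide)) SimpleGraph.Walk.nil, by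
    simp [SimpleGraph.Walk.isPath_def]⟩

/-- `x_c ≤ Z((0,0),(0,1))`. [folklore] -/
theorem le_weight_00_01 : ENNReal.ofReal SAW.criticalFugacity ≤ SAW.weight Ω₃ 1 ![0, 0] ![0, 1] Set.univ := by
  have h := single_le_weight_univ γ₀₀₀₁
  rwa [show γ₀₀₀₁.length = 1 from rfl, pow_one] at h

/-- `x_c ≤ Z((1,1),(2,1))`. [folklore] -/
theorem le_weight_11_21 : ENNReal.ofReal SAW.criticalFugacity ≤ SAW.weight Ω₃ 1 ![1, 1] ![2, 1] Set.univ := by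
  have h := single_le_weight_univ γ₁₁₂₁
  rwa [show γ₁₁₂₁.length = 1 from rfl, pow_one] at h

/-- SAW `(0,0) → (1,0) → (1,1)`. [folklore] -/
def P₁ : SAW.DomainSAW Ω₃ 1 ![0, 0] ![1, 1] :=
  ⟨.cons (adj₃ (y := ![1, 0]) (by decide)) (.cons (adj₃ (by decide)) .nil), by
    simp [SimpleGraph.Walk.isPath_def]⟩

/-- SAW `(0,1) → (0,2) → (1,2) → (2,2) → (2,1)`. [folklore] -/
def Q₁ : SAW.DomainSAW Ω₃ 1 ![0, 1] ![2, 1] :=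
  ⟨.cons (adj₃ (y := ![0, 2]) (by decide)) (.cons (adj₃ (y := ![1, 2]) (by decide))
    (.cons (adj₃ (y := ![2, 2]) (by decide)) (.cons (adj₃ (by decide)) .nil))), by
    simp [SimpleGraph.Walk.isPath_def]⟩

/-- SAW `(0,0) → (1,0) → (2,0) → (2,1)`. [folklore] -/
def P₂ : SAW.DomainSAW Ω₃ 1 ![0, 0] ![2, 1] :=
  ⟨.cons (adj₃ (y := ![1, 0]) (by decide)) (.cons (adj₃ (y := ![2, 0]) (by decide))
    (.cons (adj₃ (by decide)) .nil)), by
    simp [SimpleGraph.Walk.isPath_def]⟩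

/-- SAW `(1,1) → (0,1)`. [folklore] -/
def Q₂ : SAW.DomainSAW Ω₃ 1 ![1, 1] ![0, 1] :=
  ⟨.cons (adj₃ (by decide)) .nil, by simp [SimpleGraph.Walk.isPath_def]⟩

end Box3

end Summit.CriticalPhenomena.SAWScalingLimit.Theorems.BoundaryTP2.Negative
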